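import Summits.BirchSwinnertonDyer.Rank1Residual.Supersingular.KobayashiConverseReal
import Summits.BirchSwinnertonDyer.Rank1Residual.Additive.TameBranchBudgetSqueeze
import Literature.NumberTheory.EllipticCurves.GreenbergVatsal2000.CongruentCurves
import HarnessLib

/-!
# Route `SignedLowerHalves`, crux `KobayashiMainConjectureSmallImage` (item stmt-BirchSwinnertonDyer-19002):
# the `μ`-SATURATION, part 1 (image-free Λ-algebra) — at small image Kobayashi's RATIONAL Kato
# divisibility is INTEGRAL as soon as `μ(X^ε) = 0`; hence `μ(X^ε) = 0 + BSD(E,p) ⇒` the main conjecture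
# in rank `0`, and `μ(X^ε) = 0 +` the Eisenstein half `⇒` the equality in ANY rank
# (cell `bsd-ssimc`, seat `bsd-ssimc-k3-c4` gen 4; helper file, `--supports … --as helper`)

HONEST FRAMING: Kobayashi's signed main conjecture at a non-surjective (normaliser-of-non-split-Cartan)
image is OPEN; nothing here proves it for the class. This file proves CONDITIONAL, IMAGE-FREE theorems
whose non-published inputs are DISPLAYED binders (`μ(X^ε(E/ℚ_∞)) = 0` for the dual data; in rank `0`
also `BSD(E,p)`; in §3 the Eisenstein half); everything else is a PUBLISHED named fact consumed BY
NAME (Kobayashi 2003 Thm. 1.2 / Thm. 4.1 RATIONAL clause, B. D. Kim 2013 Cor. 3.15, GZK, modularity,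
the period-unit facts). No preprint binder occurs. The companion file
`SignedLowerHalvesKobayashiMainConjectureSmallImageMuTransferCM.lean` supplies `μ(X^ε(E)) = 0` from a
CM partner by B. D. Kim 2009 Cor. 2.13 (PUBLISHED). Item 4 stays OPEN; nothing is booked; BSD is not
proved by any of this.

PARTITION (cell bsd-ssimc): X7 (A7) × the non-surjective `a_p = 0` pairs (item 4's window: 136) —
types-the-object-of; closes NONE.

## The observation

The b2b rank-`0` converse `Supersingular.kobayashiMainConjecture_of_bsdp_of_analyticRank_eq_zero`
(`KobayashiConverseReal.lean`: `BSD(E,p)` settled in rank `0` ⇒ Kobayashi's main conjecture) uses the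
surjectivity of `ρ̄_{E,p}` at exactly ONE line — to take `n = 0` in Kobayashi's Thm. 4.1
(`Char(X^ε) ⊇ (pⁿ L_p^ε)`; `n = 0` needs `ρ_{E,p^∞}` onto). On item 4's domain the image is never
onto; but the RATIONAL clause `ξ^ε ∣ pⁿ·L_p^ε` (tree fact `thm41_….exists_dvd_pow_mul`, NO image
hypothesis) is already an integral divisibility `ξ^ε ∣ L_p^ε` whenever `p ∤ ξ^ε` in `Λ`, i.e. whenever
`μ(X^ε) = 0` — Gauss' lemma for the prime element `p ∈ Λ = ℤ_p⟦T⟧`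
(`Additive.dvd_of_dvd_C_pow_mul_of_hasUnitContent`). So at small image `μ(X^ε) = 0` REPLACES
surjectivity:

* §1 `signedUpper_dvd_of_hasUnitContent` — `char X^ε = (ξ)`, `HasUnitContent ξ` ⟹ `ξ ∣ L_p^ε`.
* §2 `kobayashiMainConjecture_of_mu_eq_zero_of_bsdp_of_analyticRank_eq_zero` — the IMAGE-FREE rank-0
  converse: odd good `p`, `a_p = 0`, `μ(X^ε) = 0` for every dual datum (in the conjecture's own
  cyclotomic setting), `r_an = 0`, `BSD(E,p)` ⟹ `KobayashiMainConjecture W p ε` (the b2b proof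
  verbatim with `Surj` ↦ `μ = 0`: constant terms `ord_p ξ(0) = ord_p(∏c_ℓ·#Ш)` by Kim + GZK,
  `ord_p L^ε(0) = ord_p(#Ш_an·∏c_ℓ)` by Kobayashi (3.6) + period units, equal by `BSD(E,p)`).
* §3 `kobayashiMainConjecture_of_mu_eq_zero_of_lowerDivisibility` — SATURATION in ANY rank:
  `μ(X^ε) = 0` + the Eisenstein half `KobayashiLowerDivisibility W p ε` ⟹ the equality (lower
  `g = C(u)·L^ε·h`, upper `g ∣ L^ε` ⟹ `h ∈ Λ^×`). No `BSD(E,p)`, no rank hypothesis, no rank-one link —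
  the `μ`-form of the registered stub `stub_saturationSmallImage` («lower ⟹ equality» = the
  `μ`-statement, MEMO-1 §0.2), now a kernel theorem modulo the displayed `μ = 0`.

What is NOT here: any source of `μ(X^ε) = 0` (companion file: CM partner + B. D. Kim 2009); the
Eisenstein half itself (`stub_lowerSmallImage`, no engine in print); anything booked.

References: [Kobayashi2003] Thm. 1.2, Thm. 4.1, (3.6), Conjecture (p. 2); [BDKim2013] Cor. 3.15;
[Pollack2003] Prop. 6.18; [GreenbergVatsal2000] p. 2 (1)–(2), §3 Rem. 3.4; [Washington1997] §7.1,
§13.1; [Miller2011LMS] Def. 1.1.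
-/

set_option autoImplicit false
set_option linter.dupNamespace false

noncomputable section

open scoped Classical MatrixGroups ModularForm

open CongruenceSubgroup WeierstrassCurve Literature.NumberTheory.EllipticCurves
  Literature.NumberTheory.EllipticCurves.ModularForms
  Literature.NumberTheory.EllipticCurves.Rank1Residual
  Literature.NumberTheory.EllipticCurves.Rank1Residual.Typed
  Literature.NumberTheory.EllipticCurves.Kobayashi2003 ZpExtension
  Literature.NumberTheory.EllipticCurves.GreenbergVatsal2000
  Summit.BirchSwinnertonDyer.Rank1Residual.Supersingular
  Summit.BirchSwinnertonDyer.Rank1Residual.X1.MuLambda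

namespace Summit.BirchSwinnertonDyer.BirchSwinnertonDyer.Theorems

/-! ### §1 Λ-algebra: the rational Kato divisibility is integral when `μ(X^ε) = 0` -/

section Upper

variable {W : WeierstrassCurve ℚ} [W.IsElliptic] [W.IsGloballyMinimal] {p : ℕ} [Fact p.Prime]
  {N : ℕ} [NeZero N] {f : CuspForm (Gamma0 N) 2}
  {κ : ZpExtension ℚ p} {γ : Field.absoluteGaloisGroup ℚ} {ε : ℤˣ}

/-- **Integral Kato divisibility with NO image hypothesis, given `μ(X^ε) = 0`.** Kobayashi's Thm. 4.1
(tree fact `h41`, RATIONAL clause — `ξ^ε ∣ pⁿ·L_p^ε` for a characteristic power series `ξ^ε` of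
`X^ε(E/ℚ_∞)`, valid for ANY Galois image) and unit content of `ξ^ε` (`p ∤ ξ^ε`, i.e. `μ(X^ε) = 0`)
give `ξ^ε ∣ L_p^ε` in `Λ`, by Gauss' lemma for the prime element `p ∈ Λ = ℤ_p⟦T⟧`
(`Additive.dvd_of_dvd_C_pow_mul_of_hasUnitContent`). This is the one place where the b2b rank-`0`
converse used surjectivity of `ρ̄_{E,p}`. [cite: Kobayashi2003, Thm. 4.1 (p. 8)] [cite: Washington1997, §13.1 and §7.1] -/
theorem signedUpper_dvd_of_hasUnitContent (h41 : thm41_signedCharIdeal_divisibility) (hp : p ≠ 2)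
    (hgood : W.HasGoodReductionAtPrime p) (hap : W.frobeniusTrace p = 0) (hf : IsNewformOf W f)
    (hκ : κ.IsCyclotomic) (hγ : κ.IsTopGenerator γ) (hγ' : IsCyclotomicVariable p γ)
    {L : IwasawaAlgebra p} (hL : IsSignedPAdicLFunction f p ε L)
    (D : SignedSelmerDualData W κ γ ε) [Module.Finite (IwasawaAlgebra p) D.X]
    (hX : Module.IsTorsion (IwasawaAlgebra p) D.X)
    {ξ : IwasawaAlgebra p} (hξ : D.charIdeal = Ideal.span {ξ}) (hu : HasUnitContent ξ) : ξ ∣ L := by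
  obtain ⟨n, hn⟩ := h41.exists_dvd_pow_mul hp hgood hap hf hκ hγ hγ' hL D hX hξ
  have hC : ((p : IwasawaAlgebra p) ^ n : IwasawaAlgebra p) = PowerSeries.C ((p : ℤ_[p]) ^ n) := by
    rw [map_pow, map_natCast]
  rw [hC] at hn
  exact Summit.BirchSwinnertonDyer.Rank1Residual.Additive.dvd_of_dvd_C_pow_mul_of_hasUnitContent hu n hn

end Upper

/-! ### §2 The IMAGE-FREE rank-zero converse: `μ(X^ε) = 0` + `BSD(E,p)` ⇒ the main conjecture -/

section ConverseMu

variable (W : WeierstrassCurve ℚ) [W.IsElliptic] [W.IsGloballyMinimal] (p : ℕ) [Fact p.Prime]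

/-- **`BSD(E,p)` settled in rank `0` and `μ(X^ε(E/ℚ_∞)) = 0` ⇒ Kobayashi's main conjecture for
`(E, p, ε)`, with NO hypothesis on the Galois image.** Let `p` be an odd prime of good reduction of
`E = W` with `a_p = 0`, `ord_{s=1}L(E,s) = 0`, `BSDp W p`, and suppose every Pontryagin-dual datum of
`Sel^ε(E/ℚ_∞)` has `μ = 0` (`hμ`, in the conjecture's own cyclotomic setting). Granted BY NAME
Kobayashi 2003 Thm. 1.2 (`h12`), Thm. 4.1 (`h41`, RATIONAL clause only), B. D. Kim 2013 Cor. 3.15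
(`hKim`), the period-unit facts (`h5`, `h3`), GZK (`hGZK`) and modularity (`hmod'`):
`KobayashiMainConjecture W p ε`. Proof = the b2b converse
`Supersingular.kobayashiMainConjecture_of_bsdp_of_analyticRank_eq_zero` VERBATIM except that the
integral divisibility `ξ ∣ L^ε` comes from §1 (`μ = 0` + Gauss' lemma) instead of surjectivity:
`ord_p ξ(0) = ord_p(∏c_ℓ·#Ш)` ((K) + GZK), `ord_p L^ε(0) = ord_p(L(E,1)/Ω_E) = ord_p(#Ш_an·∏c_ℓ)`
((P), `p ∤ c_ε`, `ϖ ∈ ℤ_p^×`, `p ∤ #tors`), equal by `BSD(E,p)`, so the cofactor is a unit.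
CONDITIONAL on the displayed binders; PER PAIR; nothing asserted beyond them.
[cite: Kobayashi2003, Thm. 1.2 (p. 2), Thm. 4.1 (p. 8), (3.6) (p. 7) and Conjecture (p. 2)]
[cite: BDKim2013, Cor. 3.15 (p. 199)] [cite: GreenbergVatsal2000, p. 2 (2) and §3 Remark 3.4]
[cite: Miller2011LMS, Def. 1.1] -/
theorem kobayashiMainConjecture_of_mu_eq_zero_of_bsdp_of_analyticRank_eq_zero
    (h12 : Kobayashi2003.thm12_signedSelmerDual_finite_torsion)
    (h41 : Kobayashi2003.thm41_signedCharIdeal_divisibility)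
    (hKim : BDKim2013.cor315_signedCharValue_rankZero)
    (h5 : realPeriodRat_eq_unit_mul_plusPeriod) (h3 : realPeriodRat_eq_unit_mul_plusPeriod_three)
    (hGZK : rank_eq_analyticRank_of_analyticRank_le_one) (hmod' : hasEntireLFunction_rat)
    (hp : p ≠ 2) (hgood : W.HasGoodReductionAtPrime p) (hap : W.frobeniusTrace p = 0) {ε : ℤˣ}
    (hμ : ∀ (κ : ZpExtension ℚ p) (γ : Field.absoluteGaloisGroup ℚ),
      κ.IsCyclotomic → κ.IsTopGenerator γ → IsCyclotomicVariable p γ →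
      ∀ (D : SignedSelmerDualData W κ γ ε), D.mu = 0)
    (h0 : W.analyticRank = 0) (hB : BSDp W p) :
    KobayashiMainConjecture W p ε := by
  intro κ γ hκ hγ hγ' _ f hf ϖ hϖ Lplus Lminus hPP D
  have hpP : p.Prime := Fact.out
  -- Thm. 1.2: `X^ε` finitely generated and torsion
  haveI hfin : Module.Finite (IwasawaAlgebra p) D.X := h12.moduleFinite hp hgood hap hκ hγ D
  have hX : Module.IsTorsion (IwasawaAlgebra p) D.X := h12.isTorsion hp hgood hap hκ hγ D
  refine ⟨hX, ?_⟩
  -- a generator `ξ` of `Char(X^ε)` (unit content by `hμ`), Kobayashi's `L^ε`, and §1: `ξ ∣ L^ε`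
  obtain ⟨ξ, hξ⟩ := (charIdeal_isPrincipal_holds p D.X).principal
  have hξ' : D.charIdeal = Ideal.span {ξ} := hξ
  have huξ : HasUnitContent ξ :=
    (muInvariant_eq_zero_iff_hasUnitContent D.X hX hξ').mp (hμ κ γ hκ hγ hγ' D)
  set L := kobayashiL ε Lplus Lminus with hL_def
  have hL : IsSignedPAdicLFunction f p ε L := hPP.isSignedPAdicLFunction_kobayashiL ε
  have hU : ξ ∣ L := signedUpper_dvd_of_hasUnitContent h41 hp hgood hap hf hκ hγ hγ' hL D hX hξ' huξ
  -- `L(E,1) ≠ 0`, irreducibility, the period ratio is a unit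
  have hL1 : W.entireLFunction 1 ≠ 0 := (W.analyticRank_eq_zero_iff_holds (hmod' W)).1 h0
  have hirr : W.HasIrreducibleModPGaloisRep p :=
    hasIrreducibleModPGaloisRep_of_dvd_frobeniusTrace W p hp
      (W.not_dvd_minimalDiscriminantInt_of_hasGoodReductionAtPrime' p hgood) (by rw [hap]; exact dvd_zero _)
  have hvϖ : padicValRat p ϖ = 0 := padicValRat_periodRatio_eq_zero h5 h3 W p hp hgood hirr f hf ϖ hϖ
  have hϖ0 : ϖ ≠ 0 := by
    intro hz
    rw [hz, Rat.cast_zero, zero_mul] at hϖ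
    exact (IsNewform0.plusPeriod_pos_holds hf.1 hf.coeffField_eq_bot).ne' hϖ.symm
  -- (K): `ξ(0) ≠ 0`, `ord_p ξ(0) = ord_p ∏c + ord_p #Ш`
  have hK : (⟨ξ, 0, 0⟩ : SignedDatum W p).EulerCharacteristic :=
    BDKim2013.cor315_signedCharValue_rankZero.eulerCharacteristic hKim hp hgood hap hκ hγ D ⟨hfin, hX⟩
      hξ'
  obtain ⟨hξ0ne, hvξ⟩ := valuation_constantCoeff_xi W p hGZK hL1 ⟨ξ, 0, 0⟩ hK
  -- (P), proved: `L(0) = c_ε · [0]⁺_f`; `t := ϖ·[0]⁺_f = L(E,1)/Ω_E`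
  have hLε := hPP.constantCoeff_kobayashiL hp hf hgood hap ε
  set s : ℚ := ratPlusSymbol f 0 with hs_def
  set t : ℚ := ϖ * s with ht_def
  have hLval : W.entireLFunction 1 = (((s : ℝ) * plusPeriod f : ℝ) : ℂ) := hf.entireLFunction_one_eq
  have ht : W.entireLFunction 1 / (W.realPeriodRat : ℂ) = ((t : ℚ) : ℂ) := by
    rw [hLval, ← hϖ, div_eq_iff (Complex.ofReal_ne_zero.mpr W.realPeriodRat_pos_holds.ne'), ht_def]
    push_cast
    ring
  have hs0 : s ≠ 0 := by
    intro hz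
    apply hL1
    rw [hLval, hz]
    simp
  have ht0 : t ≠ 0 := mul_ne_zero hϖ0 hs0
  -- `ord_p L(0) = ord_p s = ord_p t`
  have hcne : kobayashiConst p ε ≠ 0 := fun hz ↦
    not_dvd_kobayashiConst hp ε (by rw [hz]; exact dvd_zero p)
  have hc0 : (kobayashiConst p ε : ℚ_[p]) ≠ 0 := by exact_mod_cast hcne
  have hsQ0 : ((s : ℚ) : ℚ_[p]) ≠ 0 := by exact_mod_cast hs0
  have hL0ne : ((PowerSeries.constantCoeff L : ℤ_[p]) : ℚ_[p]) ≠ 0 := by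
    rw [hLε]; exact mul_ne_zero hc0 hsQ0
  have hvL : (((PowerSeries.constantCoeff L : ℤ_[p]) : ℚ_[p])).valuation = padicValRat p t := by
    rw [hLε, Padic.valuation_mul hc0 hsQ0, Padic.valuation_natCast,
      padicValNat.eq_zero_of_not_dvd (not_dvd_kobayashiConst hp ε), Padic.valuation_ratCast, ht_def,
      padicValRat.mul hϖ0 hs0, hvϖ]
    simp
  -- `BSD(E,p)`: `ord_p #Ш_an = ord_p #Ш` with `#Ш_an = t·#tors²/∏c`, `p ∤ #tors`
  haveI : Finite W.sha := (hGZK W (by omega)).2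
  obtain ⟨q, hq, hvq⟩ := missingPPartAt_of_bsdp W p hB
  have hq' : q = t * (W.torsionOrder : ℚ) ^ 2 / (W.tamagawaProduct : ℚ) := by
    have hqq := hq.symm.trans (shaAn_eq_of_analyticRank_eq_zero W hGZK h0 ht)
    exact_mod_cast hqq
  rw [hq', padicValRat_shaAn_witness W p hirr ht0] at hvq
  -- equal valuations ⇒ `(ξ) = (L)`
  have hv : (((PowerSeries.constantCoeff ξ : ℤ_[p]) : ℚ_[p])).valuation =
      (((PowerSeries.constantCoeff L : ℤ_[p]) : ℚ_[p])).valuation := by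
    have hvξ' : (((PowerSeries.constantCoeff ξ : ℤ_[p]) : ℚ_[p])).valuation =
        (padicValNat p W.tamagawaProduct : ℤ) + padicValNat p W.shaOrder := hvξ
    rw [hvξ', hvL]
    linarith
  have hspan : Ideal.span ({ξ} : Set (IwasawaAlgebra p)) = Ideal.span {L} :=
    span_eq_span_of_dvd_of_valuation_constantCoeff_eq hU hL0ne hv
  -- `g := ϖ·L`, `ϖ ∈ ℤ_p^×`
  obtain ⟨u, hu⟩ := exists_units_coe_eq_ratCast hϖ0 hvϖ
  obtain ⟨hspan', hι⟩ := span_C_units_mul_eq u L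
  refine ⟨PowerSeries.C (u : ℤ_[p]) * L, ?_, ?_⟩
  · rw [hξ', hspan, hspan']
  · rw [hι, hu]

end ConverseMu

/-! ### §3 SATURATION in any rank: `μ(X^ε) = 0` + the Eisenstein half ⇒ the equality -/

section Saturation

variable (W : WeierstrassCurve ℚ) [W.IsElliptic] [W.IsGloballyMinimal] (p : ℕ) [Fact p.Prime]

/-- **Saturation (`lower ⇒ equality`) from `μ(X^ε) = 0`, ANY analytic rank, NO image hypothesis.**
Let `p` be an odd prime of good reduction of `E = W` with `a_p = 0`, and suppose every dual datum
of `Sel^ε(E/ℚ_∞)` has `μ = 0` (`hμ`). Granted BY NAME Kobayashi Thm. 1.2 (`h12`), Thm. 4.1 RATIONAL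
(`h41`) and the period-unit facts (`h5`, `h3`): the Eisenstein half `KobayashiLowerDivisibility W p ε`
implies `KobayashiMainConjecture W p ε`. Proof: lower gives `char X^ε = (g)`, `ι g = ϖ·ι(L^ε·h)`, so
`g = C(u)·L^ε·h` (`ϖ = u ∈ ℤ_p^×`); `μ(g) = 0` and §1 give `g ∣ L^ε`, `L^ε = g·h'`; hence
`g = g·(C(u)·h'·h)` in the domain `Λ` with `g ≠ 0`, so `h ∈ Λ^×` and `char X^ε = (C(u)·L^ε)`.
No `BSD(E,p)`, no rank hypothesis, no rank-one link. CONDITIONAL on the displayed binders.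
[cite: Kobayashi2003, Thm. 1.2 (p. 2), Thm. 4.1 (p. 8) and Conjecture (p. 2)]
[cite: GreenbergVatsal2000, p. 2 (2) and §3 Remark 3.4] -/
theorem kobayashiMainConjecture_of_mu_eq_zero_of_lowerDivisibility
    (h12 : Kobayashi2003.thm12_signedSelmerDual_finite_torsion)
    (h41 : Kobayashi2003.thm41_signedCharIdeal_divisibility)
    (h5 : realPeriodRat_eq_unit_mul_plusPeriod) (h3 : realPeriodRat_eq_unit_mul_plusPeriod_three)
    (hp : p ≠ 2) (hgood : W.HasGoodReductionAtPrime p) (hap : W.frobeniusTrace p = 0) {ε : ℤˣ}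
    (hμ : ∀ (κ : ZpExtension ℚ p) (γ : Field.absoluteGaloisGroup ℚ),
      κ.IsCyclotomic → κ.IsTopGenerator γ → IsCyclotomicVariable p γ →
      ∀ (D : SignedSelmerDualData W κ γ ε), D.mu = 0)
    (hlow : KobayashiLowerDivisibility W p ε) :
    KobayashiMainConjecture W p ε := by
  intro κ γ hκ hγ hγ' _ f hf ϖ hϖ Lplus Lminus hPP D
  haveI hfin : Module.Finite (IwasawaAlgebra p) D.X := h12.moduleFinite hp hgood hap hκ hγ D
  have hX : Module.IsTorsion (IwasawaAlgebra p) D.X := h12.isTorsion hp hgood hap hκ hγ D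
  refine ⟨hX, ?_⟩
  set L := kobayashiL ε Lplus Lminus with hL_def
  have hL : IsSignedPAdicLFunction f p ε L := hPP.isSignedPAdicLFunction_kobayashiL ε
  -- the Eisenstein half: `char X^ε = (g)`, `ι g = ϖ · ι (L · h)`
  obtain ⟨g, h, hchar, hιg⟩ := hlow κ γ hκ hγ hγ' f hf ϖ hϖ Lplus Lminus hPP D
  have hug : HasUnitContent g :=
    (muInvariant_eq_zero_iff_hasUnitContent D.X hX hchar).mp (hμ κ γ hκ hγ hγ' D)
  have hg0 : g ≠ 0 := Summit.BirchSwinnertonDyer.Rank1Residual.X11a.ne_zero_of_hasUnitContent hug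
  -- §1: the upper half `g ∣ L`
  have hU : g ∣ L := signedUpper_dvd_of_hasUnitContent h41 hp hgood hap hf hκ hγ hγ' hL D hX hchar hug
  obtain ⟨h', hh'⟩ := hU
  -- the period ratio is a unit: `ϖ = u`
  have hirr : W.HasIrreducibleModPGaloisRep p :=
    hasIrreducibleModPGaloisRep_of_dvd_frobeniusTrace W p hp
      (W.not_dvd_minimalDiscriminantInt_of_hasGoodReductionAtPrime' p hgood) (by rw [hap]; exact dvd_zero _)
  have hvϖ : padicValRat p ϖ = 0 := padicValRat_periodRatio_eq_zero h5 h3 W p hp hgood hirr f hf ϖ hϖ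
  have hϖ0 : ϖ ≠ 0 := by
    intro hz
    rw [hz, Rat.cast_zero, zero_mul] at hϖ
    exact (IsNewform0.plusPeriod_pos_holds hf.1 hf.coeffField_eq_bot).ne' hϖ.symm
  obtain ⟨u, hu⟩ := exists_units_coe_eq_ratCast hϖ0 hvϖ
  obtain ⟨hspanu, hιu⟩ := span_C_units_mul_eq u (L * h)
  -- `g = C(u) · (L · h)`
  have hgeq : g = PowerSeries.C (u : ℤ_[p]) * (L * h) :=
    iwasawaToPowerSeries_injective p (by rw [hιg, hιu, hu])
  -- `h` is a unit: `g · 1 = g · (C u · h' · h)`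
  have hunit : IsUnit h := by
    have hmul : g * 1 = g * (PowerSeries.C (u : ℤ_[p]) * h' * h) := by
      calc g * 1 = g := mul_one g
        _ = PowerSeries.C (u : ℤ_[p]) * (L * h) := hgeq
        _ = PowerSeries.C (u : ℤ_[p]) * (g * h' * h) := by rw [hh']
        _ = g * (PowerSeries.C (u : ℤ_[p]) * h' * h) := by ring
    have h1 : PowerSeries.C (u : ℤ_[p]) * h' * h = 1 := (mul_left_cancel₀ hg0 hmul).symm
    exact IsUnit.of_mul_eq_one_right _ h1
  -- conclusion: `char X^ε = (C u · L)`, `ι (C u · L) = ϖ · ι L`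
  obtain ⟨hspan', hι⟩ := span_C_units_mul_eq u L
  refine ⟨PowerSeries.C (u : ℤ_[p]) * L, ?_, ?_⟩
  · rw [hchar, hgeq, ← mul_assoc]
    exact Ideal.span_singleton_mul_right_unit hunit _
  · rw [hι, hu]

end Saturation

end Summit.BirchSwinnertonDyer.BirchSwinnertonDyer.Theorems

end
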